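import Literature.Computability.FineGrained.KSatExponentGap
import Literature.Computability.Complexity.CNF
import Literature.Computability.Complexity.Transducers
import Literature.Combinatorics.BinomialEntropyBound
import Mathlib.Data.List.Sublists
import HarnessLib

/-!
# Exhaustive search of light assignments, I: the budgeted splitting search and the token code

Family `fine-grained` (trunk T-CPLX-FINE). Groundwork for the discharge of the named fact
`Literature.Computability.FineGrained.lightKSAT_exhaustiveSearch` (`KSatExponentGap.lean`; Impagliazzo–Paturi 2001,
p. 370 and proof of Theorem 3, step 1: "the assignments with at most `δ n` ones can be
searched exhaustively in time `2^{h(δ) n}`", `δ = 1/N`), which — unlike plain exhaustive search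
(`kSATInExpTime_one`, in the tree) — must stay below the full `2^n`: the machine enumerates
only the *light* partial assignments. This file is the machine-free part.

**Part I — the budgeted splitting search** on clause lists `Literature.CplxCore.CNF V` (`CNF.lean`)
over an abstract variable type `V` (for the machine, bit strings):

* `restrict F x v` (`F[x := v]`: clauses with the literal `(x, v)` removed, the literal
  `(x, !v)` deleted from the others, kept literals in reverse order), `pivot F` (variable of the
  first literal of the first clause);
* `LightSat F b` — some assignment satisfies `F` with at most `b` ones *on the variables of `F`*;
  `lightSat_iff_or` — the budgeted splitting rule: `F[x:=false]` with budget `b`, or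
  `F[x:=true]` with budget `b - 1` if `b ≥ 1`;
* `searchB n W` — the worklist loop on pairs (budget, formula); `nodesB b F` — its number of
  iterations on the subtree of `(b, F)`; `searchB_iff` (correctness);
* `nodesB_le` — **the size of the budgeted search tree**:
  `nodesB b F ≤ (d + 1) · Σ_{j ≤ b} (d choose j)`, `d = #vars F` (Pascal's rule), and, with
  van Lint's Theorem 1.4.5 (`BinomialEntropyBound.lean`), `sumChoose_le_two_rpow`:
  `Σ_{j ≤ ⌊n/N⌋} (n choose j) ≤ 2 ^ (h(1/N) n)` for `N ≥ 2`;
* the worklist invariant `WInv` (at most `d + 1` pending formulas).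

**Part II — the token code and the input transducer** (as for plain exhaustive search, with a
budget token): `Tok` (`pol b ↦ 01b`, `bit b ↦ 1b`, `endl ↦ 001`, `endc ↦ 0000`,
`endf ↦ 00010`, `unit ↦ 00011`), `formulaToks`, `bits`; `formulaOf φ` (indices replaced by their
binary codes) with `lightSat_formulaOf_iff : LightSat (formulaOf φ) w ↔ φ.LightSatisfiable w`
and `card_vars_formulaOf_le`; the transducer `recodeFST` from `Γ'` to bits emitting the
`numVars` header as `bit` tokens closed by `endl`, then the clause list
(`recodeFST_eval_encode`, linear time `exists_recode_machine`, length `≤ 4 L + 3`).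

## References

* R. Impagliazzo, R. Paturi, *On the complexity of k-SAT*, JCSS 62 (2001), p. 370 and proof
  of Theorem 3, step 1 (p. 374).
* J. H. van Lint, *Introduction to Coding Theory*, 2nd ed., Springer 1992, Theorem 1.4.5 (i).
* M. Davis, G. Logemann, D. Loveland, *A machine program for theorem-proving*, Comm. ACM 5
  (1962), 394–397 (the splitting rule).
-/

namespace Literature.Computability.FineGrained.LightSearch

open _root_.Computability Complexity Finset

variable {V : Type}

/-! ### Satisfiability of clause lists, literal form -/

/-- `CNF.Satisfiable` in literal form. [folklore] -/
theorem satisfiable_iff (F : CNF V) :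
    F.Satisfiable ↔ ∃ a : V → Bool, ∀ c ∈ F, ∃ l ∈ c, a l.1 = l.2 := by
  simp only [CNF.Satisfiable, CNF.eval_eq_true_iff, Clause.eval, List.any_eq_true, Literal.eval,
    beq_iff_eq]

/-- The pivot: the variable of the first literal of the first clause, if any. [folklore] -/
def pivot : CNF V → Option V
  | ((x, _) :: _) :: _ => some x
  | _ => none

/-- A nonempty formula without empty clause has a pivot. [folklore] -/
theorem pivot_isSome {F : CNF V} (h₁ : F ≠ []) (h₂ : [] ∉ F) : (pivot F).isSome := by
  match F, h₁, h₂ with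
  | [], h₁, _ => exact (h₁ rfl).elim
  | [] :: _, _, h₂ => exact (h₂ (by simp)).elim
  | ((y, b) :: c) :: F', _, _ => rfl

/-- The number of ones of the assignment `a` on the set `S`. [folklore] -/
def onesOn (S : Finset V) (a : V → Bool) : ℕ := (S.filter fun x => a x = true).card

/-- `onesOn` is monotone in the set. [folklore] -/
theorem onesOn_mono {S T : Finset V} (h : S ⊆ T) (a : V → Bool) : onesOn S a ≤ onesOn T a :=
  Finset.card_le_card (Finset.filter_subset_filter _ h)

section Dec

variable [DecidableEq V]

/-- Membership in `CNF.vars`. [folklore] -/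
theorem mem_vars {F : CNF V} {x : V} : x ∈ CNF.vars F ↔ ∃ c ∈ F, ∃ l ∈ c, l.1 = x := by
  constructor
  · intro h
    rw [CNF.vars, List.mem_toFinset, List.mem_map] at h
    obtain ⟨l, hl, rfl⟩ := h
    rw [List.mem_flatten] at hl
    obtain ⟨c, hc, hlc⟩ := hl
    exact ⟨c, hc, l, hlc, rfl⟩
  · rintro ⟨c, hc, l, hl, rfl⟩
    rw [CNF.vars, List.mem_toFinset, List.mem_map]
    exact ⟨l, List.mem_flatten.2 ⟨c, hc, hl⟩, rfl⟩

/-- `F[x := v]`: drop the clauses containing the literal `(x, v)`, delete the literals on `x`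
from the other clauses (their kept literals are listed in reverse order).
[Davis–Logemann–Loveland 1962, splitting rule] [folklore] -/
def restrict (F : CNF V) (x : V) (v : Bool) : CNF V :=
  (F.filter fun c => (x, v) ∉ c).map fun c => (c.filter fun l => l.1 ≠ x).reverse

/-- The pivot occurs in the formula. [folklore] -/
theorem mem_vars_of_pivot {F : CNF V} {x : V} (h : pivot F = some x) : x ∈ CNF.vars F := by
  match F, h with
  | ((y, b) :: c) :: F', h =>
    simp only [pivot, Option.some.injEq] at h
    subst h
    exact mem_vars.2 ⟨(y, b) :: c, by simp, (y, b), by simp, rfl⟩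

/-- Restriction removes the pivot variable and adds none. [folklore] -/
theorem vars_restrict_subset (F : CNF V) (x : V) (v : Bool) :
    CNF.vars (restrict F x v) ⊆ (CNF.vars F).erase x := by
  intro y hy
  obtain ⟨c', hc', l, hl, rfl⟩ := mem_vars.1 hy
  obtain ⟨c, hc, rfl⟩ := List.mem_map.1 hc'
  rw [List.mem_reverse, List.mem_filter] at hl
  obtain ⟨hlc, hlx⟩ := hl
  simp only [ne_eq, decide_not, Bool.not_eq_eq_eq_not, Bool.not_true,
    decide_eq_false_iff_not] at hlx
  exact Finset.mem_erase.2 ⟨hlx, mem_vars.2 ⟨c, (List.mem_filter.1 hc).1, l, hlc, rfl⟩⟩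

/-- Hence restriction at an occurring variable decreases the number of variables. [folklore] -/
theorem card_vars_restrict_le {F : CNF V} {x : V} (hx : x ∈ CNF.vars F) (v : Bool) :
    (CNF.vars (restrict F x v)).card + 1 ≤ (CNF.vars F).card :=
  (Finset.card_le_card (vars_restrict_subset F x v)).trans_lt (Finset.card_erase_lt_of_mem hx)

/-! ### Light satisfiability and the budgeted splitting rule -/

/-- `LightSat F b`: some assignment satisfies `F` with at most `b` ones on the variables of `F`
(the other variables are irrelevant and may be taken `false`).
[cite: ImpagliazzoPaturiJCSS2001, p. 370 (assignments with at most δn 1's)] -/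
def LightSat (F : CNF V) (b : ℕ) : Prop :=
  ∃ a : V → Bool, (∀ c ∈ F, ∃ l ∈ c, a l.1 = l.2) ∧ onesOn (CNF.vars F) a ≤ b

/-- The empty formula is lightly satisfiable with any budget. [folklore] -/
theorem lightSat_nil (b : ℕ) : LightSat ([] : CNF V) b :=
  ⟨fun _ => false, by simp, by simp [onesOn]⟩

/-- A formula with an empty clause is not lightly satisfiable. [folklore] -/
theorem not_lightSat_of_nil_mem {F : CNF V} (h : [] ∈ F) (b : ℕ) : ¬ LightSat F b := by
  rintro ⟨a, ha, -⟩
  obtain ⟨l, hl, -⟩ := ha [] h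
  exact List.not_mem_nil hl

/-- One direction of the splitting rule, downwards: an assignment satisfying `F[x := v]` and
vanishing outside its variables extends (by `x ↦ v`) to one satisfying `F`. [folklore] -/
theorem sat_of_sat_restrict {F : CNF V} {x : V} {v : Bool} {a : V → Bool}
    (ha : ∀ c ∈ restrict F x v, ∃ l ∈ c, a l.1 = l.2) :
    ∀ c ∈ F, ∃ l ∈ c, (fun y => if y = x then v else
      if y ∈ CNF.vars (restrict F x v) then a y else false) l.1 = l.2 := by
  intro c hc
  by_cases hxc : (x, v) ∈ c
  · exact ⟨(x, v), hxc, by simp⟩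
  · have hc' : (c.filter fun l => l.1 ≠ x).reverse ∈ restrict F x v :=
      List.mem_map.2 ⟨c, List.mem_filter.2 ⟨hc, by simpa using hxc⟩, rfl⟩
    obtain ⟨l, hl, hal⟩ := ha _ hc'
    have hl' := hl
    rw [List.mem_reverse, List.mem_filter] at hl
    obtain ⟨hlc, hlx⟩ := hl
    simp only [ne_eq, decide_not, Bool.not_eq_eq_eq_not, Bool.not_true,
      decide_eq_false_iff_not] at hlx
    refine ⟨l, hlc, ?_⟩
    have hmem : l.1 ∈ CNF.vars (restrict F x v) := mem_vars.2 ⟨_, hc', l, hl', rfl⟩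
    simp [hlx, hmem, hal]

/-- **The budgeted splitting rule.** `F` is satisfiable with at most `b` ones on its variables
iff `F[x := false]` is (same budget) or `b ≥ 1` and `F[x := true]` is with budget `b - 1`
(for an occurring `x`). [Davis–Logemann–Loveland 1962; IP 2001 p. 370] [folklore] -/
theorem lightSat_iff_or {F : CNF V} {x : V} (hx : x ∈ CNF.vars F) (b : ℕ) :
    LightSat F b ↔ LightSat (restrict F x false) b ∨ (1 ≤ b ∧ LightSat (restrict F x true) (b - 1)) := by
  constructor
  · rintro ⟨a, ha, hb⟩
    have key : ∀ v, a x = v → ∀ c ∈ restrict F x v, ∃ l ∈ c, a l.1 = l.2 := by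
      intro v hv c' hc'
      obtain ⟨c, hc, rfl⟩ := List.mem_map.1 hc'
      obtain ⟨hcF, hxc⟩ := List.mem_filter.1 hc
      obtain ⟨l, hl, hal⟩ := ha c hcF
      refine ⟨l, ?_, hal⟩
      rw [List.mem_reverse, List.mem_filter]
      refine ⟨hl, ?_⟩
      by_contra hlx
      simp only [ne_eq, decide_not, Bool.not_eq_eq_eq_not, Bool.not_true,
        decide_eq_false_iff_not, not_not] at hlx
      have : l = (x, v) := Prod.ext hlx (by rw [← hal, hlx, hv])
      simp only [decide_eq_true_eq] at hxc
      exact hxc (this ▸ hl)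
    cases hax : a x
    · left
      refine ⟨a, key false hax, (onesOn_mono ((vars_restrict_subset F x false).trans
        (Finset.erase_subset _ _)) a).trans hb⟩
    · right
      have hsub := vars_restrict_subset F x true
      have h1 : onesOn (CNF.vars (restrict F x true)) a + 1 ≤ onesOn (CNF.vars F) a := by
        unfold onesOn
        have : (CNF.vars (restrict F x true)).filter (fun y => a y = true) ⊆
            ((CNF.vars F).filter fun y => a y = true).erase x := by
          intro y hy
          rw [Finset.mem_filter] at hy
          have := hsub hy.1
          rw [Finset.mem_erase] at this
          exact Finset.mem_erase.2 ⟨this.1, Finset.mem_filter.2 ⟨this.2, hy.2⟩⟩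
        have hxm : x ∈ (CNF.vars F).filter fun y => a y = true := Finset.mem_filter.2 ⟨hx, hax⟩
        have := Finset.card_le_card this
        rw [Finset.card_erase_of_mem hxm] at this
        have hpos := Finset.card_pos.2 ⟨x, hxm⟩
        omega
      exact ⟨by omega, a, key true hax, by omega⟩
  · rintro (⟨a, ha, hb⟩ | ⟨hb1, a, ha, hb⟩)
    · refine ⟨fun y => if y = x then false else
        if y ∈ CNF.vars (restrict F x false) then a y else false, sat_of_sat_restrict ha, ?_⟩
      refine le_trans ?_ hb
      unfold onesOn
      refine Finset.card_le_card_of_injOn id (fun y hy => ?_) (Set.injOn_id _)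
      simp only [Finset.coe_filter, Set.mem_setOf_eq] at hy ⊢
      obtain ⟨-, hy⟩ := hy
      by_cases hyx : y = x
      · simp [hyx] at hy
      · simp only [hyx, ↓reduceIte] at hy
        by_cases hmem : y ∈ CNF.vars (restrict F x false)
        · exact ⟨hmem, by simpa [hmem] using hy⟩
        · simp [hmem] at hy
    · refine ⟨fun y => if y = x then true else
        if y ∈ CNF.vars (restrict F x true) then a y else false, sat_of_sat_restrict ha, ?_⟩
      have hsplit : ((CNF.vars F).filter fun y => (fun y => if y = x then true else
          if y ∈ CNF.vars (restrict F x true) then a y else false) y = true) ⊆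
          insert x ((CNF.vars (restrict F x true)).filter fun y => a y = true) := by
        intro y hy
        simp only [Finset.mem_filter] at hy
        obtain ⟨-, hy⟩ := hy
        by_cases hyx : y = x
        · simp [hyx]
        · simp only [hyx, ↓reduceIte] at hy
          by_cases hmem : y ∈ CNF.vars (restrict F x true)
          · exact Finset.mem_insert_of_mem (Finset.mem_filter.2 ⟨hmem, by simpa [hmem] using hy⟩)
          · simp [hmem] at hy
      unfold onesOn at hb ⊢
      have := (Finset.card_le_card hsplit).trans (Finset.card_insert_le _ _)
      omega

/-! ### The budgeted search and the size of its tree -/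

/-- **The budgeted worklist search** with fuel `n`: pop `(b, F)`; the empty formula is
satisfiable; a formula with an empty clause is dropped; otherwise split on the pivot `x`,
pushing `(b, F[x:=false])` above `(b - 1, F[x:=true])`, the latter only if `b ≥ 1`.
[Davis–Logemann–Loveland 1962; IP 2001 p. 370] [folklore] -/
def searchB : ℕ → List (ℕ × CNF V) → Bool
  | 0, _ => false
  | _ + 1, [] => false
  | n + 1, (b, F) :: W =>
    if F = [] then true
    else if [] ∈ F then searchB n W
    else match pivot F with
      | none => searchB n W
      | some x => searchB n ((b, restrict F x false) ::
          (if b = 0 then W else (b - 1, restrict F x true) :: W))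

/-- The number of loop iterations spent on the subtree of `(b, F)`. [folklore] -/
def nodesB (b : ℕ) (F : CNF V) : ℕ :=
  if _ : F ≠ [] ∧ [] ∉ F then
    match hp : pivot F with
    | none => 1
    | some x => 1 + nodesB b (restrict F x false) +
        (if b = 0 then 0 else nodesB (b - 1) (restrict F x true))
  else 1
termination_by (CNF.vars F).card
decreasing_by
  all_goals
    have h0 := card_vars_restrict_le (mem_vars_of_pivot hp) false
    have h1 := card_vars_restrict_le (mem_vars_of_pivot hp) true
    omega

/-- `nodesB` of a leaf. [folklore] -/
theorem nodesB_of_leaf {F : CNF V} (h : F = [] ∨ [] ∈ F) (b : ℕ) : nodesB b F = 1 := by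
  rw [nodesB, dif_neg]
  tauto

/-- `nodesB` of an inner node. [folklore] -/
theorem nodesB_of_pivot {F : CNF V} (h₁ : F ≠ []) (h₂ : [] ∉ F) {x : V}
    (hp : pivot F = some x) (b : ℕ) :
    nodesB b F = 1 + nodesB b (restrict F x false) +
      (if b = 0 then 0 else nodesB (b - 1) (restrict F x true)) := by
  rw [nodesB, dif_pos ⟨h₁, h₂⟩]
  split
  · simp_all
  · next y hy => rw [hp] at hy; cases hy; rfl

/-- Every subtree has at least one node. [folklore] -/
theorem one_le_nodesB (b : ℕ) (F : CNF V) : 1 ≤ nodesB b F := by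
  by_cases h : F ≠ [] ∧ [] ∉ F
  · obtain ⟨x, hx⟩ := Option.isSome_iff_exists.1 (pivot_isSome h.1 h.2)
    rw [nodesB_of_pivot h.1 h.2 hx]; omega
  · rw [nodesB_of_leaf (by tauto)]

/-- The partial binomial sum `Σ_{j ≤ b} (d choose j)`. [folklore] -/
def sumChoose (d b : ℕ) : ℕ := ∑ j ∈ range (b + 1), d.choose j

/-- `Σ_{j ≤ 0} (d choose j) = 1`. [folklore] -/
@[simp] theorem sumChoose_zero (d : ℕ) : sumChoose d 0 = 1 := by simp [sumChoose]

/-- `1 ≤ Σ_{j ≤ b} (d choose j)`. [folklore] -/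
theorem one_le_sumChoose (d b : ℕ) : 1 ≤ sumChoose d b := by
  unfold sumChoose
  calc 1 = d.choose 0 := (Nat.choose_zero_right d).symm
    _ ≤ ∑ j ∈ range (b + 1), d.choose j :=
        Finset.single_le_sum (f := fun j => d.choose j) (fun _ _ => Nat.zero_le _) (by simp)

/-- Pascal's rule, summed: `Σ_{j ≤ b+1} (d+1 choose j) = Σ_{j ≤ b+1} (d choose j) + Σ_{j ≤ b} (d choose j)`. [folklore] -/
theorem sumChoose_succ_succ (d b : ℕ) :
    sumChoose (d + 1) (b + 1) = sumChoose d (b + 1) + sumChoose d b := by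
  unfold sumChoose
  rw [Finset.sum_range_succ' (fun j => (d + 1).choose j), Finset.sum_range_succ' (fun j => d.choose j)]
  simp only [Nat.choose_succ_succ, Finset.sum_add_distrib, Nat.choose_zero_right]
  ring

/-- Monotonicity in `d`. [folklore] -/
theorem sumChoose_mono_left {d d' : ℕ} (h : d ≤ d') (b : ℕ) : sumChoose d b ≤ sumChoose d' b :=
  Finset.sum_le_sum fun j _ => Nat.choose_mono j h

/-- Monotonicity in `b`. [folklore] -/
theorem sumChoose_mono_right (d : ℕ) {b b' : ℕ} (h : b ≤ b') : sumChoose d b ≤ sumChoose d b' :=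
  Finset.sum_le_sum_of_subset (Finset.range_subset_range.2 (by omega))

/-- **Size of the budgeted search tree**: `nodesB b F ≤ (#vars F + 1) · Σ_{j ≤ b} (#vars F choose j)`.
[cite: ImpagliazzoPaturiJCSS2001, p. 370 (exhaustive search of light assignments)] -/
theorem nodesB_le (b : ℕ) (F : CNF V) :
    nodesB b F ≤ ((CNF.vars F).card + 1) * sumChoose (CNF.vars F).card b := by
  suffices H : ∀ d (F : CNF V) b, (CNF.vars F).card ≤ d → nodesB b F ≤ (d + 1) * sumChoose d b by
    exact H _ F b le_rfl
  intro d
  induction d with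
  | zero =>
    intro F b hF
    by_cases h : F ≠ [] ∧ [] ∉ F
    · obtain ⟨x, hx⟩ := Option.isSome_iff_exists.1 (pivot_isSome h.1 h.2)
      have := Finset.card_pos.2 ⟨x, mem_vars_of_pivot hx⟩
      omega
    · rw [nodesB_of_leaf (by tauto)]; have := one_le_sumChoose 0 b; omega
  | succ d ih =>
    intro F b hF
    by_cases h : F ≠ [] ∧ [] ∉ F
    · obtain ⟨x, hx⟩ := Option.isSome_iff_exists.1 (pivot_isSome h.1 h.2)
      rw [nodesB_of_pivot h.1 h.2 hx]
      have hxF := mem_vars_of_pivot hx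
      have c0 := card_vars_restrict_le hxF false
      have c1 := card_vars_restrict_le hxF true
      have h0 := ih (restrict F x false) b (by omega)
      have hs1 := one_le_sumChoose (d + 1) b
      rcases b with _ | b
      · simp only [↓reduceIte, add_zero, sumChoose_zero, mul_one] at h0 ⊢
        omega
      · have h1 := ih (restrict F x true) b (by omega)
        simp only [Nat.add_one_ne_zero, ↓reduceIte, Nat.add_sub_cancel]
        rw [sumChoose_succ_succ]
        have := one_le_sumChoose d (b + 1)
        have := one_le_sumChoose d b
        nlinarith
    · rw [nodesB_of_leaf (by tauto)]
      have := one_le_sumChoose (d + 1) b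
      nlinarith

/-- **The entropy bound** (van Lint's Theorem 1.4.5 (i)): for `N ≥ 2`,
`Σ_{j ≤ ⌊n/N⌋} (n choose j) ≤ 2 ^ (h(1/N) · n)` with `h(1/N) = binEntropy N⁻¹ / log 2`.
[cite: Vanlint1992, Theorem 1.4.5 (i) (pp. 66–67)] -/
theorem sumChoose_le_two_rpow (n N : ℕ) (hN : 2 ≤ N) :
    (sumChoose n (n / N) : ℝ) ≤ (2 : ℝ) ^ (Real.binEntropy (N : ℝ)⁻¹ / Real.log 2 * n) := by
  have hN0 : (0 : ℝ) < N := by exact_mod_cast (show 0 < N by omega)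
  have h0 : (0 : ℝ) ≤ (N : ℝ)⁻¹ := by positivity
  have h1 : (N : ℝ)⁻¹ ≤ 1 / 2 := by
    rw [inv_le_comm₀ hN0 (by norm_num)]
    simpa using (show (2 : ℝ) ≤ N by exact_mod_cast hN)
  have hfl : ⌊(N : ℝ)⁻¹ * n⌋₊ = n / N := by
    rw [inv_mul_eq_div, Nat.floor_div_natCast, Nat.floor_natCast]
  have := Literature.Combinatorics.vanLint_sum_choose_le_two_rpow n h0 h1
  rw [hfl] at this
  simpa [sumChoose] using this

/-- **Correctness of the budgeted search**: with fuel at least the total number of nodes,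
`searchB` tells whether some pending `(b, F)` has `LightSat F b`.
[Davis–Logemann–Loveland 1962; IP 2001 p. 370] [folklore] -/
theorem searchB_iff : ∀ (n : ℕ) (W : List (ℕ × CNF V)), (W.map fun p => nodesB p.1 p.2).sum ≤ n →
    (searchB n W = true ↔ ∃ p ∈ W, LightSat p.2 p.1) := by
  intro n
  induction n with
  | zero =>
    intro W hW
    match W with
    | [] => simp [searchB]
    | (b, F) :: W => have := one_le_nodesB b F; simp at hW; omega
  | succ n ih =>
    intro W hW
    match W with
    | [] => simp [searchB]
    | (b, F) :: W =>
      simp only [List.map_cons, List.sum_cons] at hW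
      by_cases hF : F = []
      · subst hF
        simp only [searchB, ↓reduceIte, List.mem_cons, exists_eq_or_imp, true_iff]
        exact Or.inl (lightSat_nil b)
      by_cases hn : [] ∈ F
      · rw [searchB, if_neg hF, if_pos hn, ih W (by have := one_le_nodesB b F; omega)]
        simp only [List.mem_cons, exists_eq_or_imp, iff_or_self]
        exact fun h => (not_lightSat_of_nil_mem hn b h).elim
      obtain ⟨x, hx⟩ := Option.isSome_iff_exists.1 (pivot_isSome hF hn)
      rw [searchB, if_neg hF, if_neg hn, hx]
      simp only
      rw [nodesB_of_pivot hF hn hx] at hW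
      have hiff := lightSat_iff_or (mem_vars_of_pivot hx) b
      by_cases hb : b = 0
      · subst hb
        rw [if_pos rfl, ih _ (by simp only [List.map_cons, List.sum_cons] at hW ⊢; omega)]
        simp only [List.mem_cons, exists_eq_or_imp, hiff]
        simp
      · rw [if_neg hb, ih _ (by simp only [List.map_cons, List.sum_cons, hb, ↓reduceIte] at hW ⊢; omega)]
        simp only [List.mem_cons, exists_eq_or_imp, hiff]
        constructor
        · rintro (h | h | h)
          · exact Or.inl (Or.inl h)
          · exact Or.inl (Or.inr ⟨by omega, h⟩)
          · exact Or.inr h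
        · rintro ((h | ⟨-, h⟩) | h)
          · exact Or.inl h
          · exact Or.inr (Or.inl h)
          · exact Or.inr (Or.inr h)

/-! ### The worklist invariant -/

/-- The worklist invariant for `d` variables: the `j`-th pending formula has at most
`d - (|W| - 1 - j)` variables. [folklore] -/
def WInv (d : ℕ) (W : List (ℕ × CNF V)) : Prop :=
  ∀ j : Fin W.length, (CNF.vars (W.get j).2).card + (W.length - 1 - j) ≤ d

/-- The initial worklist satisfies the invariant. [folklore] -/
theorem WInv.singleton {d b : ℕ} {F : CNF V} (h : (CNF.vars F).card ≤ d) : WInv d [(b, F)] := by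
  intro j
  obtain ⟨j, hj⟩ := j
  simp only [List.length_singleton, Nat.lt_one_iff] at hj
  subst hj
  simpa using h

/-- Dropping the top formula preserves the invariant. [folklore] -/
theorem WInv.tail {d : ℕ} {p : ℕ × CNF V} {W : List (ℕ × CNF V)} (h : WInv d (p :: W)) :
    WInv d W := by
  intro j
  have := h ⟨j + 1, by simp⟩
  simp only [List.length_cons, List.get_eq_getElem, List.getElem_cons_succ] at this
  simp only [List.get_eq_getElem]
  omega

/-- Pushing one child preserves the invariant. [folklore] -/
theorem WInv.push1 {d b b₀ : ℕ} {F : CNF V} {W : List (ℕ × CNF V)} (h : WInv d ((b, F) :: W))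
    {x : V} (hx : x ∈ CNF.vars F) (v : Bool) : WInv d ((b₀, restrict F x v) :: W) := by
  intro j
  have h0 := h ⟨0, by simp⟩
  simp only [List.length_cons, List.get_eq_getElem, List.getElem_cons_zero, tsub_zero] at h0
  rcases j with ⟨_ | j, hj⟩
  · have := card_vars_restrict_le hx v
    simp only [List.length_cons, List.get_eq_getElem, List.getElem_cons_zero]
    omega
  · have := h ⟨j + 1, by simp at hj ⊢; omega⟩
    simp only [List.length_cons, List.get_eq_getElem, List.getElem_cons_succ] at this ⊢
    omega

/-- Splitting the top formula preserves the invariant. [folklore] -/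
theorem WInv.split {d b b₀ b₁ : ℕ} {F : CNF V} {W : List (ℕ × CNF V)} (h : WInv d ((b, F) :: W))
    {x : V} (hx : x ∈ CNF.vars F) :
    WInv d ((b₀, restrict F x false) :: (b₁, restrict F x true) :: W) := by
  intro j
  have h0 := h ⟨0, by simp⟩
  simp only [List.length_cons, List.get_eq_getElem, List.getElem_cons_zero, tsub_zero] at h0
  rcases j with ⟨_ | _ | j, hj⟩
  · have := card_vars_restrict_le hx false
    simp only [List.length_cons, List.get_eq_getElem, List.getElem_cons_zero]
    omega
  · have := card_vars_restrict_le hx true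
    simp only [List.length_cons, List.get_eq_getElem, List.getElem_cons_succ,
      List.getElem_cons_zero]
    omega
  · have := h ⟨j + 1, by simp at hj ⊢; omega⟩
    simp only [List.length_cons, List.get_eq_getElem, List.getElem_cons_succ] at this ⊢
    omega

/-- Under the invariant the worklist holds at most `d + 1` formulas. [folklore] -/
theorem WInv.length_le {d : ℕ} {W : List (ℕ × CNF V)} (h : WInv d W) : W.length ≤ d + 1 := by
  rcases W with _ | ⟨p, W⟩
  · simp
  · have := h ⟨0, by simp⟩
    simp only [List.length_cons, List.get_eq_getElem, List.getElem_cons_zero] at this ⊢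
    omega

/-! ### Sizes: restriction does not lengthen codes -/

/-- For any additive length function on literals with a per-clause overhead, the total length
of `F[x := v]` is at most that of `F`. [folklore] -/
theorem weight_restrict_le (w : V × Bool → ℕ) (e : ℕ) (F : CNF V) (x : V) (v : Bool) :
    ((restrict F x v).map fun c => (c.map w).sum + e).sum ≤
      (F.map fun c => (c.map w).sum + e).sum := by
  unfold restrict
  rw [List.map_map]
  have h1 : ((F.filter fun c => (x, v) ∉ c).map ((fun c => (c.map w).sum + e) ∘
      fun c => (c.filter fun l => l.1 ≠ x).reverse)).sum ≤
      ((F.filter fun c => (x, v) ∉ c).map fun c => (c.map w).sum + e).sum := by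
    refine List.sum_le_sum fun c _ => ?_
    simp only [Function.comp_apply, List.map_reverse, List.sum_reverse, add_le_add_iff_right]
    exact List.Sublist.sum_le_sum ((List.filter_sublist (l := c)).map w) fun _ _ => Nat.zero_le _
  have h2 : ((F.filter fun c => (x, v) ∉ c).map fun c => (c.map w).sum + e).sum ≤
      (F.map fun c => (c.map w).sum + e).sum :=
    List.Sublist.sum_le_sum ((List.filter_sublist (l := F)).map _) fun _ _ => Nat.zero_le _
  exact h1.trans h2

end Dec

/-! ### Tokens and their prefix code -/

/-- Tokens of the worklist code: start of a literal with its polarity, an index bit, end of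
literal, end of clause, end of formula, and a budget unit. [folklore] -/
inductive Tok
  | pol (b : Bool)
  | bit (b : Bool)
  | endl
  | endc
  | endf
  | unit
  deriving DecidableEq

/-- The prefix code of tokens over bits. [folklore] -/
def Tok.code : Tok → List Bool
  | .bit b => [true, b]
  | .pol b => [false, true, b]
  | .endl => [false, false, true]
  | .endc => [false, false, false, false]
  | .endf => [false, false, false, true, false]
  | .unit => [false, false, false, true, true]

/-- Every token code has length at most `5`. [folklore] -/
theorem Tok.length_code_le (t : Tok) : t.code.length ≤ 5 := by
  cases t <;> simp [Tok.code]

/-- Every token code has length at least `2`. [folklore] -/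
theorem Tok.two_le_length_code (t : Tok) : 2 ≤ t.code.length := by
  cases t <;> simp [Tok.code]

/-- The bit string of a token string. [folklore] -/
def bits (ts : List Tok) : List Bool :=
  ts.flatMap Tok.code

/-- `bits` of a concatenation. [folklore] -/
@[simp] theorem bits_append (s t : List Tok) : bits (s ++ t) = bits s ++ bits t := by
  simp [bits]

/-- `bits` of a cons. [folklore] -/
@[simp] theorem bits_cons (a : Tok) (t : List Tok) : bits (a :: t) = a.code ++ bits t := by
  simp [bits]

/-- `bits` of the empty string. [folklore] -/
@[simp] theorem bits_nil : bits [] = [] := rfl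

/-- A token string is at most as long as its bit string. [folklore] -/
theorem length_le_length_bits (ts : List Tok) : ts.length ≤ (bits ts).length := by
  induction ts with
  | nil => simp
  | cons t ts ih => have := t.two_le_length_code; simp; omega

/-- A bit string is at most five times as long as its token string. [folklore] -/
theorem length_bits_le (ts : List Tok) : (bits ts).length ≤ 5 * ts.length := by
  induction ts with
  | nil => simp
  | cons t ts ih => have := t.length_code_le; simp; omega

/-- `bits` of a replicated token. [folklore] -/
theorem bits_replicate (n : ℕ) (t : Tok) :
    bits (List.replicate n t) = (List.replicate n t.code).flatten := by
  induction n with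
  | zero => rfl
  | succ n ih => simp [List.replicate_succ, ih]

/-- The tokens of a literal `(w, b)` (index bits `w`, polarity `b`). [folklore] -/
def litToks (l : List Bool × Bool) : List Tok :=
  Tok.pol l.2 :: l.1.map Tok.bit ++ [Tok.endl]

/-- The tokens of a clause. [folklore] -/
def clauseToks (c : Clause (List Bool)) : List Tok :=
  c.flatMap litToks ++ [Tok.endc]

/-- The tokens of a formula (clause list). [folklore] -/
def formulaToks (F : CNF (List Bool)) : List Tok :=
  F.flatMap clauseToks

/-- Tokens of a cons of clauses. [folklore] -/
@[simp] theorem formulaToks_cons (c : Clause (List Bool)) (F : CNF (List Bool)) :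
    formulaToks (c :: F) = clauseToks c ++ formulaToks F := by
  simp [formulaToks]

/-- Tokens of the empty formula. [folklore] -/
@[simp] theorem formulaToks_nil : formulaToks [] = [] := rfl

/-- Tokens of a concatenation of formulas. [folklore] -/
@[simp] theorem formulaToks_append (F G : CNF (List Bool)) :
    formulaToks (F ++ G) = formulaToks F ++ formulaToks G := by
  simp [formulaToks]

/-- The tokens of the `numVars` header: its bits, closed by `endl`. [folklore] -/
def hdrToks (n : ℕ) : List Tok := (encodeNat n).map Tok.bit ++ [Tok.endl]

/-! ### The clause list of a `KCNF` -/

variable {k : ℕ}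

/-- The clause list of a k-CNF with variable indices replaced by their binary codes
`encodeNat`. [folklore] -/
def formulaOf (φ : KCNF k) : CNF (List Bool) :=
  φ.clauses.map fun c => c.map fun l => (encodeNat l.1, l.2)

/-- `encodeNat` is injective (it has the left inverse `decodeNat`). [folklore] -/
theorem decodeNat_leftInverse : Function.LeftInverse decodeNat encodeNat := decode_encodeNat

/-- The variables of the coded clause list are codes of indices `< numVars`. [folklore] -/
theorem vars_formulaOf_subset (φ : KCNF k) :
    CNF.vars (formulaOf φ) ⊆ (Finset.range φ.numVars).image encodeNat := by
  intro w hw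
  obtain ⟨c', hc', l', hl', rfl⟩ := mem_vars.1 hw
  obtain ⟨c, hc, rfl⟩ := List.mem_map.1 hc'
  obtain ⟨l, hl, rfl⟩ := List.mem_map.1 hl'
  exact Finset.mem_image.2 ⟨l.1, Finset.mem_range.2 (φ.fst_lt_numVars c hc l hl), rfl⟩

/-- **The coded clause list has at most `numVars` variables.** [folklore] -/
theorem card_vars_formulaOf_le (φ : KCNF k) : (CNF.vars (formulaOf φ)).card ≤ φ.numVars :=
  (Finset.card_le_card (vars_formulaOf_subset φ)).trans
    (Finset.card_image_le.trans (by simp))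

/-- **Light satisfiability of the coded clause list is light satisfiability of the k-CNF**
(assignments of the `numVars` variables with at most `w` ones). [folklore] -/
theorem lightSat_formulaOf_iff (φ : KCNF k) (w : ℕ) :
    LightSat (formulaOf φ) w ↔ φ.LightSatisfiable w := by
  constructor
  · rintro ⟨a, ha, hb⟩
    set v : Fin φ.numVars → Bool := fun i =>
      if encodeNat i.1 ∈ CNF.vars (formulaOf φ) then a (encodeNat i.1) else false with hv
    refine ⟨v, ?_, ?_⟩
    · -- weight: `i ↦ encodeNat i` injects the ones of `v` into the ones of `a` on the variables
      rw [hammingNorm_eq_card_filter_eq_true]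
      refine le_trans ?_ hb
      unfold onesOn
      refine Finset.card_le_card_of_injOn (fun i => encodeNat i.1) (fun i hi => ?_) ?_
      · simp only [Finset.coe_filter, Finset.mem_univ, true_and, Set.mem_setOf_eq] at hi
        simp only [Finset.coe_filter, Set.mem_setOf_eq]
        by_cases hmem : encodeNat i.1 ∈ CNF.vars (formulaOf φ)
        · exact ⟨hmem, by simpa [hv, hmem] using hi⟩
        · simp [hv, hmem] at hi
      · intro i _ j _ hij
        exact Fin.ext (decodeNat_leftInverse.injective hij)
    · -- satisfaction
      simp only [KCNF.evalFin, KCNF.eval, List.all_eq_true, List.any_eq_true, beq_iff_eq]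
      intro c hc
      obtain ⟨l', hl', hal⟩ := ha (c.map fun l => (encodeNat l.1, l.2)) (List.mem_map.2 ⟨c, hc, rfl⟩)
      obtain ⟨l, hl, rfl⟩ := List.mem_map.1 hl'
      refine ⟨l, hl, ?_⟩
      have hlt := φ.fst_lt_numVars c hc l hl
      have hmem : encodeNat l.1 ∈ CNF.vars (formulaOf φ) :=
        mem_vars.2 ⟨_, List.mem_map.2 ⟨c, hc, rfl⟩, (encodeNat l.1, l.2), List.mem_map.2 ⟨l, hl, rfl⟩, rfl⟩
      rw [dif_pos hlt]
      simpa [hv, hmem] using hal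
  · rintro ⟨v, hvw, hv⟩
    simp only [KCNF.evalFin, KCNF.eval, List.all_eq_true, List.any_eq_true, beq_iff_eq] at hv
    set V : ℕ → Bool := fun i => if h : i < φ.numVars then v ⟨i, h⟩ else false with hV
    refine ⟨fun w' => V (decodeNat w'), ?_, ?_⟩
    · intro c' hc'
      obtain ⟨c, hc, rfl⟩ := List.mem_map.1 hc'
      obtain ⟨l, hl, hvl⟩ := hv c hc
      exact ⟨(encodeNat l.1, l.2), List.mem_map.2 ⟨l, hl, rfl⟩, by simpa [decode_encodeNat] using hvl⟩
    · -- weight: `w' ↦ decodeNat w'` injects the ones of `a` on the variables into the ones of `v`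
      rw [hammingNorm_eq_card_filter_eq_true] at hvw
      have hsub := vars_formulaOf_subset φ
      have hinj : Set.InjOn decodeNat (CNF.vars (formulaOf φ) : Set (List Bool)) := by
        intro w₁ hw₁ w₂ hw₂ h
        obtain ⟨i₁, -, rfl⟩ := Finset.mem_image.1 (hsub hw₁)
        obtain ⟨i₂, -, rfl⟩ := Finset.mem_image.1 (hsub hw₂)
        simp only [decode_encodeNat] at h
        rw [h]
      unfold onesOn
      set S := (CNF.vars (formulaOf φ)).filter fun w' => V (decodeNat w') = true with hS
      set T := (Finset.univ : Finset (Fin φ.numVars)).filter fun i => v i = true with hT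
      have h1 : (S.image decodeNat).card = S.card :=
        Finset.card_image_of_injOn (hinj.mono (by rw [hS]; exact_mod_cast Finset.filter_subset _ _))
      have h2 : S.image decodeNat ⊆ T.image Fin.val := by
        intro i hi
        obtain ⟨w', hw', rfl⟩ := Finset.mem_image.1 hi
        rw [hS, Finset.mem_filter] at hw'
        obtain ⟨hw'1, hw'2⟩ := hw'
        obtain ⟨j, hj, rfl⟩ := Finset.mem_image.1 (hsub hw'1)
        rw [Finset.mem_range] at hj
        simp only [decode_encodeNat, hV, hj, dif_pos] at hw'2 ⊢
        exact Finset.mem_image.2 ⟨⟨j, hj⟩, by rw [hT]; exact Finset.mem_filter.2 ⟨Finset.mem_univ _, hw'2⟩, rfl⟩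
      have h3 : (T.image Fin.val).card = T.card := Finset.card_image_of_injective _ Fin.val_injective
      calc S.card = (S.image decodeNat).card := h1.symm
        _ ≤ (T.image Fin.val).card := Finset.card_le_card h2
        _ = T.card := h3
        _ ≤ w := hvw

/-! ### The input transducer -/

/-- States of the input transducer: in the `numVars` header, between literals, inside a
literal. [folklore] -/
inductive RSt
  | hdr
  | cl
  | lit
  deriving DecidableEq

/-- finiteness, by enumeration [folklore] -/
instance : Fintype RSt := ⟨{.hdr, .cl, .lit}, by intro x; cases x <;> simp⟩

/-- Transitions of the input transducer: the header bits are emitted as `bit` tokens and the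
header is closed by `endl` at the first comma; then a bit after a bracket or comma starts a
literal (`pol`), further bits are index bits (`bit`), a comma ends the literal (`endl`), a
closing bracket ends the clause (`endc`); opening brackets and blanks emit nothing. [folklore] -/
def recodeStep : RSt → Γ' → RSt × List Bool
  | .hdr, .bit b => (.hdr, (Tok.bit b).code)
  | .hdr, .comma => (.cl, Tok.endl.code)
  | .hdr, _ => (.hdr, [])
  | .cl, .bit b => (.lit, (Tok.pol b).code)
  | .cl, .ket => (.cl, Tok.endc.code)
  | .cl, _ => (.cl, [])
  | .lit, .bit b => (.lit, (Tok.bit b).code)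
  | .lit, .comma => (.cl, Tok.endl.code)
  | .lit, .ket => (.cl, Tok.endc.code)
  | .lit, _ => (.lit, [])

/-- **The input transducer**: from Wave0's `Γ'`-encoding of a k-CNF to the token code of its
header and clause list. [folklore] -/
def recodeFST : FST RSt Γ' Bool where
  init := .hdr
  step := recodeStep
  front _ := []
  keep _ := true

/-- The header is recoded to its tokens. [folklore] -/
theorem run_hdr (bs : List Bool) (rest : List Γ') :
    recodeFST.run .hdr (bs.map Γ'.bit ++ Γ'.comma :: rest) =
      ((recodeFST.run .cl rest).1,
        bits (bs.map Tok.bit) ++ Tok.endl.code ++ (recodeFST.run .cl rest).2) := by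
  induction bs with
  | nil => simp [recodeFST, recodeStep]
  | cons b bs ih =>
    rw [List.map_cons, List.cons_append, FST.run_cons]
    simp only [recodeFST, recodeStep] at ih ⊢
    rw [ih]
    simp

/-- Inside a literal: the index bits are recoded one by one, the comma closes the literal.
[folklore] -/
theorem run_lit (w : List Bool) (rest : List Γ') :
    recodeFST.run .lit (w.map Γ'.bit ++ Γ'.comma :: rest) =
      ((recodeFST.run .cl rest).1,
        bits (w.map Tok.bit) ++ Tok.endl.code ++ (recodeFST.run .cl rest).2) := by
  induction w with
  | nil => simp [recodeFST, recodeStep]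
  | cons b w ih =>
    rw [List.map_cons, List.cons_append, FST.run_cons]
    simp only [recodeFST, recodeStep] at ih ⊢
    rw [ih]
    simp

/-- A literal is recoded to its tokens. [folklore] -/
theorem run_cl_encodeLiteral (l : ℕ × Bool) (rest : List Γ') :
    recodeFST.run .cl (KCNF.encodeLiteral l ++ rest) =
      ((recodeFST.run .cl rest).1,
        bits (litToks (encodeNat l.1, l.2)) ++ (recodeFST.run .cl rest).2) := by
  have h := run_lit (encodeNat l.1) rest
  simp only [recodeFST] at h ⊢
  simp only [KCNF.encodeLiteral, List.cons_append, List.append_assoc, List.nil_append,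
    FST.run_cons, recodeStep]
  rw [h]
  simp [litToks, bits]

/-- The literals of a clause are recoded to their tokens. [folklore] -/
theorem run_cl_literals (c : List (ℕ × Bool)) (rest : List Γ') :
    recodeFST.run .cl (c.flatMap KCNF.encodeLiteral ++ rest) =
      ((recodeFST.run .cl rest).1,
        bits ((c.map fun l => (encodeNat l.1, l.2)).flatMap litToks) ++
          (recodeFST.run .cl rest).2) := by
  induction c with
  | nil => simp [bits]
  | cons l c ih =>
    rw [List.flatMap_cons, List.append_assoc, run_cl_encodeLiteral, ih]
    simp [bits]

/-- A clause is recoded to its tokens. [folklore] -/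
theorem run_cl_encodeClause (c : List (ℕ × Bool)) (rest : List Γ') :
    recodeFST.run .cl (KCNF.encodeClause c ++ rest) =
      ((recodeFST.run .cl rest).1,
        bits (clauseToks (c.map fun l => (encodeNat l.1, l.2))) ++ (recodeFST.run .cl rest).2) := by
  have h := run_cl_literals c (Γ'.ket :: rest)
  simp only [recodeFST] at h ⊢
  simp only [KCNF.encodeClause, List.cons_append, List.append_assoc, FST.run_cons, recodeStep,
    List.nil_append]
  rw [h]
  simp [recodeStep, clauseToks, bits]

/-- The clause list is recoded to its tokens. [folklore] -/
theorem run_cl_clauses (cs : List (List (ℕ × Bool))) :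
    recodeFST.run .cl (cs.flatMap KCNF.encodeClause) =
      ((recodeFST.run .cl ([] : List Γ')).1,
        bits (formulaToks (cs.map fun c => c.map fun l => (encodeNat l.1, l.2)))) := by
  induction cs with
  | nil => simp
  | cons c cs ih =>
    rw [List.flatMap_cons, run_cl_encodeClause, ih]
    simp

/-- **The input transducer computes the token code of the header and the clause list.** [folklore] -/
theorem recodeFST_eval_encode (φ : KCNF k) :
    recodeFST.eval φ.encode = bits (hdrToks φ.numVars ++ formulaToks (formulaOf φ)) := by
  rw [FST.eval, KCNF.encode]
  have h1 : recodeFST.init = RSt.hdr := rfl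
  rw [h1, run_hdr, run_cl_clauses]
  simp [recodeFST, formulaOf, hdrToks]

/-! ### Lengths -/

/-- The token code of a literal is at most `4` times as long as its `Γ'`-encoding. [folklore] -/
theorem length_bits_litToks (l : ℕ × Bool) :
    (bits (litToks (encodeNat l.1, l.2))).length ≤ 4 * (KCNF.encodeLiteral l).length := by
  simp only [litToks, bits_cons, bits_append, bits_nil, List.length_append, List.length_cons,
    Tok.code, List.length_nil, KCNF.encodeLiteral, List.length_map]
  have : (bits ((encodeNat l.1).map Tok.bit)).length = 2 * (encodeNat l.1).length := by
    induction encodeNat l.1 with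
    | nil => rfl
    | cons b w ih => simp [bits, Tok.code] at ih ⊢; omega
  omega

/-- The token code of a clause is at most `4` times as long as its `Γ'`-encoding. [folklore] -/
theorem length_bits_clauseToks (c : List (ℕ × Bool)) :
    (bits (clauseToks (c.map fun l => (encodeNat l.1, l.2)))).length ≤
      4 * (KCNF.encodeClause c).length := by
  simp only [clauseToks, bits_append, List.length_append, bits_cons, bits_nil, Tok.code,
    List.length_cons, List.length_nil, KCNF.encodeClause]
  have : (bits ((c.map fun l => (encodeNat l.1, l.2)).flatMap litToks)).length ≤
      4 * (c.flatMap KCNF.encodeLiteral).length := by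
    induction c with
    | nil => simp
    | cons l c ih =>
      simp only [List.map_cons, List.flatMap_cons, bits_append, List.length_append]
      have := length_bits_litToks l
      omega
  omega

/-- The token code of the clause list is at most `4` times as long as its part of the encoding. [folklore] -/
theorem length_bits_formulaToks_formulaOf_le (φ : KCNF k) :
    (bits (formulaToks (formulaOf φ))).length ≤ 4 * (φ.clauses.flatMap KCNF.encodeClause).length := by
  simp only [formulaOf]
  induction φ.clauses with
  | nil => simp
  | cons c cs ih =>
    simp only [List.map_cons, formulaToks_cons, bits_append, List.length_append,
      List.flatMap_cons]
    have := length_bits_clauseToks c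
    omega

/-- **The whole token code has length at most `4 L`**, `L = |φ.encode|`. [folklore] -/
theorem length_bits_hdr_formulaOf_le (φ : KCNF k) :
    (bits (hdrToks φ.numVars ++ formulaToks (formulaOf φ))).length ≤ 4 * φ.encode.length := by
  have h1 := length_bits_formulaToks_formulaOf_le φ
  have h2 : (bits ((encodeNat φ.numVars).map Tok.bit)).length = 2 * (encodeNat φ.numVars).length := by
    induction encodeNat φ.numVars with
    | nil => rfl
    | cons b w ih => simp [bits, Tok.code] at ih ⊢; omega
  simp only [hdrToks, bits_append, bits_cons, bits_nil, List.length_append, Tok.code,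
    List.length_cons, List.length_nil, KCNF.encode, List.length_map]
  omega

/-- **The input transducer runs in linear time**: some TM2 machine maps `φ.encode` to the
token code within `5 L + 3` steps (every transition emits at most `4` bits). [folklore] -/
theorem exists_recode_machine :
    ∃ M : Turing.TM2ComputableAux Γ' Bool, ∀ φ : KCNF k,
      M.OutputsWithin φ.encode (bits (hdrToks φ.numVars ++ formulaToks (formulaOf φ)))
        (5 * φ.encode.length + 3) := by
  obtain ⟨M, hM⟩ := recodeFST.timeComputable_eval
  have hE : recodeFST.maxEmit ≤ 4 := by
    refine Finset.sup_le fun p _ => ?_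
    obtain ⟨s, x⟩ := p
    cases s <;> cases x <;> simp [recodeFST, recodeStep, Tok.code]
  refine ⟨M, fun φ => ?_⟩
  have h := hM φ.encode
  simp only [id] at h
  rw [recodeFST_eval_encode] at h
  refine h.mono ?_
  have h1 : (recodeFST.maxEmit + 1) * φ.encode.length ≤ 5 * φ.encode.length :=
    Nat.mul_le_mul_right _ (by omega)
  omega

/-- Restriction does not lengthen the code. [folklore] -/
theorem length_bits_formulaToks_restrict_le (F : CNF (List Bool)) (x : List Bool) (v : Bool) :
    (bits (formulaToks (restrict F x v))).length ≤ (bits (formulaToks F)).length := by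
  have key : ∀ G : CNF (List Bool), (bits (formulaToks G)).length =
      (G.map fun c => (c.map fun l => (bits (litToks l)).length).sum + 4).sum := by
    intro G
    induction G with
    | nil => simp
    | cons c G ih =>
      rw [formulaToks_cons, bits_append, List.length_append, ih, List.map_cons, List.sum_cons]
      congr 1
      simp only [clauseToks, bits_append, List.length_append, bits_cons, bits_nil, Tok.code]
      induction c with
      | nil => simp
      | cons l c ihc => simp [bits_append] at ihc ⊢; omega
  rw [key, key]
  exact weight_restrict_le _ 4 F x v

/-- The number of variables is at most the number of tokens. [folklore] -/
theorem card_vars_le_length_formulaToks (F : CNF (List Bool)) :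
    (CNF.vars F).card ≤ (formulaToks F).length := by
  unfold CNF.vars
  refine (List.toFinset_card_le _).trans ?_
  rw [List.length_map, List.length_flatten, formulaToks, List.length_flatMap]
  refine List.sum_le_sum fun c _ => ?_
  simp only [clauseToks, List.length_append, List.length_flatMap, List.length_singleton]
  have : c.length ≤ (c.map fun l => (litToks l).length).sum := by
    induction c with
    | nil => simp
    | cons l c ih => simp [litToks]; omega
  omega

end Literature.Computability.FineGrained.LightSearch
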